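import Literature.AnabelianGeometry.SemiGraphs.TemperedReconstructionR3cProofsAt
import Literature.AnabelianGeometry.SemiGraphs.TemperedCompactInVerticialFinite
import HarnessLib

/-!
# [SemiAnbd] Cor 3.9 step (R3c) `EdgeLikeCentralizerAt` at every FINITE graph — proof-only

Mochizuki, *Semi-graphs of anabelioids*, Publ. RIMS **42** (2006), §3, Corollary 3.9, proof p. 43
l. 13 "[again by Theorem 3.7, (iii), (iv)]" [cite: MochizukiSemiAnbd2006, Cor 3.9 p.43]; Theorem 3.7 (iii),
proof p. 41 "Since the semi-graphs `𝔾_j` are all finite".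

PROOF-ONLY companion of `TemperedReconstructionR3Sub.lean` (abc-iut cell, block F fact-proving wave, seat
abc-iut-f-176; FACT-LIST rows F-2772 `EdgeLikeCentralizerAt` (schema over `(ℋ, c)`) and F-2773
`EdgeLikeCentralizer` (its closure over the graphs satisfying the hypotheses of Cor. 3.9)).  The instance
forms the cone consumes are `EdgeLikeCentralizerAt ℋ c` at graphs `ℋ` satisfying `Cor39Hypotheses`
(consumer: (R3a) `TwistAbsorption` / `twistAbsorption_holds`); abc-iut-w4-d064's
`edgeLikeCentralizerAt_of_compactInVerticialAt` reduces each of them to Theorem 3.7 (iii) AT `ℋ`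
(`CompactInVerticialAt ℋ`), and abc-iut-L3-t8's `compactInVerticialAt_of_finiteGraph`
(`TemperedCompactInVerticialFinite.lean`) proves Theorem 3.7 (iii) at every FINITE graph from
`Thm37Hypotheses` alone.  Composing the two: **(R3c) holds, unconditionally, at every finite graph of
anabelioids satisfying the hypotheses of Cor. 3.9, for every chart `π₁^temp(ℋ)`** — the case of the
semi-graphs of anabelioids of pointed stable curves (Example 3.10, Corollary 3.11: the dual semi-graph of
the geometric special fibre is finite).  The named fact `EdgeLikeCentralizer` itself quantifies over ALL
countable `ℋ` and stays open-as-typed together with Theorem 3.7 (iii) for infinite `𝔾` (cell tree-health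
RQ21); its restriction to finite graphs is `edgeLikeCentralizer_of_finite` below.  No new mathematics; no
statement file touched; nothing here takes a side on [IUTchIII] Cor. 3.12; typed ≠ proved.
-/

namespace Literature.AnabelianGeometry.SemiGraphs

namespace ProfiniteSemiGraph

universe u

variable {ℋ : ProfiniteSemiGraph.{u}}

/-- **(R3c) `EdgeLikeCentralizerAt ℋ c` at every FINITE `ℋ` satisfying the hypotheses of Cor. 3.9, for
every chart** (instance form of FACT-LIST rows F-2772 / F-2773 at finite graphs): in `π₁^temp(ℋ)` the
centraliser of the image `ψ(U)` of an open subgroup `U ⊆ Π_e` under an edge homomorphism `ψ` at `e` lies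
in every verticial subgroup containing `ψ(U)` — Theorem 3.7 (iii) at `ℋ`
(`compactInVerticialAt_of_finiteGraph`, print p. 41 "the semi-graphs `𝔾_j` are all finite") fed to
`edgeLikeCentralizerAt_of_compactInVerticialAt`. [cite: MochizukiSemiAnbd2006, Cor 3.9 p.43] -/
theorem edgeLikeCentralizerAt_of_finiteGraph [Finite ℋ.graph.Vertex] [Finite ℋ.graph.Edge]
    (hℋ : Cor39Hypotheses ℋ) (c : TemperedPiChart ℋ) : EdgeLikeCentralizerAt ℋ c :=
  edgeLikeCentralizerAt_of_compactInVerticialAt compactInVerticialAt_of_finiteGraph hℋ c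

/-- The same with the finiteness of `𝔾` as explicit hypotheses. [cite: MochizukiSemiAnbd2006, Cor 3.9 p.43] -/
theorem edgeLikeCentralizerAt_of_finiteGraph' (hV : Finite ℋ.graph.Vertex) (hE : Finite ℋ.graph.Edge)
    (hℋ : Cor39Hypotheses ℋ) (c : TemperedPiChart ℋ) : EdgeLikeCentralizerAt ℋ c :=
  edgeLikeCentralizerAt_of_finiteGraph hℋ c

/-- **(R3c) at finite graphs, binder-for-binder** (the body of `EdgeLikeCentralizerAt ℋ c` unfolded): for
finite `ℋ` as in Cor. 3.9, a chart `c`, an edge homomorphism `ψ` at `e`, an open `U ⊆ Π_e` and a verticial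
subgroup `H ∋ ψ(U)`, the centraliser of `ψ(U)` in `π₁^temp(ℋ)` lies in `H`.
[cite: MochizukiSemiAnbd2006, Cor 3.9 p.43] -/
theorem centralizer_map_le_of_mem_verticialSubgroups_of_finiteGraph [Finite ℋ.graph.Vertex]
    [Finite ℋ.graph.Edge] (hℋ : Cor39Hypotheses ℋ) (c : TemperedPiChart ℋ) (e : ℋ.graph.Edge)
    (ψ : ℋ.Ge e →ₜ* c.G) (hψ : IsEdgeHom c e ψ) (U : Subgroup (ℋ.Ge e))
    (hU : IsOpen (U : Set (ℋ.Ge e))) (v : ℋ.graph.Vertex) (H : Subgroup c.G)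
    (hH : H ∈ verticialSubgroups c v) (hUH : U.map ψ.toMonoidHom ≤ H) :
    Subgroup.centralizer ((U.map ψ.toMonoidHom : Subgroup c.G) : Set c.G) ≤ H :=
  edgeLikeCentralizerAt_of_finiteGraph hℋ c e ψ hψ U hU v H hH hUH

/-- **`EdgeLikeCentralizer` restricted to FINITE graphs** (the body of the named fact F-2773 with the extra
binders `Finite ℋ.graph.Vertex`, `Finite ℋ.graph.Edge`): for every finite graph of anabelioids `ℋ`
satisfying the hypotheses of Cor. 3.9 and every chart of `π₁^temp(ℋ)`, `EdgeLikeCentralizerAt ℋ c`.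
The unrestricted fact (all countable `ℋ`) is `edgeLikeCentralizer_of_compactInVerticial` applied to
Theorem 3.7 (iii) for every countable graph, open-as-typed. [cite: MochizukiSemiAnbd2006, Cor 3.9 p.43] -/
theorem edgeLikeCentralizer_of_finite :
    ∀ (ℋ : ProfiniteSemiGraph.{u}), Cor39Hypotheses ℋ → Finite ℋ.graph.Vertex → Finite ℋ.graph.Edge →
      ∀ (c : TemperedPiChart ℋ), EdgeLikeCentralizerAt ℋ c :=
  fun _ hℋ hV hE c => edgeLikeCentralizerAt_of_finiteGraph' hV hE hℋ c

/-- **`EdgeLikeCentralizer` from Theorem 3.7 (iii) at the Cor-3.9 graphs only**: the named fact needs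
`CompactInVerticialAt ℋ` only at the graphs `ℋ` satisfying `Cor39Hypotheses` (not at every countable
graph of anabelioids, as in `edgeLikeCentralizer_of_compactInVerticial`) — the exact residual of F-2773.
[cite: MochizukiSemiAnbd2006, Cor 3.9 p.43] -/
theorem edgeLikeCentralizer_of_compactInVerticialAt_cor39
    (hCV : ∀ (ℋ : ProfiniteSemiGraph.{u}), Cor39Hypotheses ℋ → CompactInVerticialAt ℋ) :
    EdgeLikeCentralizer.{u} :=
  fun ℋ hℋ c => edgeLikeCentralizerAt_of_compactInVerticialAt (hCV ℋ hℋ) hℋ c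

end ProfiniteSemiGraph

end Literature.AnabelianGeometry.SemiGraphs
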